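import Literature.NumberTheory.LFunctions.ConreyIwaniec2002OffDiagMellin
import HarnessLib

/-!
# Conrey–Iwaniec (2002), §6 (6.33)–(6.35) repaired: the mean square of `Φ` on `Re s = 1/(2 log q)`

B. Conrey, H. Iwaniec, Acta Arith. 103 (2002), §6 [held text `paper:arxiv-math_0111012`,
p0015:L128–p0016:L36]. Print bounds `D₀(v) ≪ C` POINTWISE from the sup of `|z(s) − Z/s|` (6.23),
with `C ≪ (ν(q)/q)L(1,χ)² log q` (6.26), `ν(q)/q = ∏_{p∣q}(1+1/p)` unbounded. The INTEGRATED form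
used by (6.39) only needs the MEAN SQUARE of `Φ(s) = κℓ²(ε₁F_{v,w}+ε₂F_{w,v})(s)·M(s)ζ(s)ζ(s+1)`
along `Re s = σ₀ = 1/(2 log q)`, which is absolutely `≪ ℓ⁴ log³ q`:
near `t = 0` (`|t| ≤ (log q)^{-1/3}`) the genus factor is absolutely bounded
(`GenusZFactorBounds.norm_sq_genusZFactor_le_near_zero`) against the weight `|s|^{-4}`
(`∫ dt/(σ₀²+t²)² ≤ π/σ₀³ = 8π log³ q`); for `(log q)^{-1/3} ≤ |t| ≤ 3` the crude factor
`(1 + log q)²` meets the weight `∫ t^{-4} ≤ log q`; for `|t| ≥ 3` everything converges.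

PROVED HERE (step C2 of the registered stub S5 `stub_offdiagonal` of SKELETON P64, cell
landau-siegel/ls-inputs, line `thm61-cm-convolution`): `exists_integral_norm_sq_genusPhi_le`.

## References
* [ConreyIwaniec2002] B. Conrey, H. Iwaniec, Acta Arith. 103 (2002) 259–312: §6 (6.23)–(6.26), (6.33)–(6.35).
-/

noncomputable section

open Complex MeasureTheory Set Filter Real
open scoped Topology

namespace Literature.NumberTheory.LFunctions

namespace ConreyIwaniec2002

namespace OffDiagPhiL2

open KernelMellin GenusZFactorBounds OffDiagMellin

/-- `∫ (1 + (t/a)²)⁻¹ dt = a π` and integrability, for `a > 0`. [folklore] -/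
private theorem integral_inv_one_add_sq_scaled {a : ℝ} (ha : 0 < a) :
    Integrable (fun t : ℝ => (1 + (a⁻¹ * t) ^ 2)⁻¹) ∧ ∫ t : ℝ, (1 + (a⁻¹ * t) ^ 2)⁻¹ = a * Real.pi := by
  refine ⟨integrable_inv_one_add_sq.comp_mul_left' (inv_ne_zero ha.ne'), ?_⟩
  have h := Measure.integral_comp_mul_left (fun x : ℝ => (1 + x ^ 2)⁻¹) a⁻¹
  simp only [inv_inv, smul_eq_mul] at h
  rw [h, integral_univ_inv_one_add_sq, abs_of_pos ha]

/-- Elementary: for `|t| ≥ 3`, `log|t| ≤ 4|t|^{1/4}`, hence `log²|t|/|t|³ ≤ 32(1+t²)⁻¹` and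
`log⁴|t|/|t|⁵ ≤ 64(1+t²)⁻¹`. [folklore] -/
private theorem far_weights_le {t : ℝ} (ht : 3 ≤ |t|) :
    Real.log |t| ^ 2 / |t| ^ (3 : ℝ) ≤ 32 * (1 + t ^ 2)⁻¹ ∧
      Real.log |t| ^ 4 / |t| ^ (5 : ℝ) ≤ 64 * (1 + t ^ 2)⁻¹ := by
  have ht0 : 0 < |t| := by linarith
  have ht1 : 1 ≤ |t| := by linarith
  have hlog0 : 0 ≤ Real.log |t| := Real.log_nonneg ht1
  have hlog : Real.log |t| ≤ 4 * |t| ^ (1 / 4 : ℝ) := by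
    have := Real.log_le_rpow_div ht0.le (by norm_num : (0:ℝ) < 1 / 4); linarith
  -- `(1+t²) ≤ 2 t²` hence `t^{-2} ≤ 2 (1+t²)⁻¹`
  have hsq : t ^ 2 = |t| ^ (2 : ℝ) := by rw [Real.rpow_two, sq_abs]
  have h9 : (9 : ℝ) ≤ t ^ 2 := by
    rw [← sq_abs]; nlinarith [abs_nonneg t]
  have hkey : (|t| ^ (2 : ℝ))⁻¹ ≤ 2 * (1 + t ^ 2)⁻¹ := by
    rw [← hsq]
    rw [show (2 : ℝ) * (1 + t ^ 2)⁻¹ = ((1 + t ^ 2) / 2)⁻¹ by rw [inv_div]; ring]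
    apply inv_anti₀ (by positivity); linarith
  have hpow2 : 0 < |t| ^ (2 : ℝ) := Real.rpow_pos_of_pos ht0 _
  constructor
  · -- log² ≤ 16 |t|^{1/2}; |t|^{1/2}/|t|^3 = |t|^{-5/2} ≤ |t|^{-2}
    have h1 : Real.log |t| ^ 2 ≤ 16 * |t| ^ (1 / 2 : ℝ) := by
      calc Real.log |t| ^ 2 ≤ (4 * |t| ^ (1 / 4 : ℝ)) ^ 2 := pow_le_pow_left₀ hlog0 hlog 2
        _ = 16 * (|t| ^ (1 / 4 : ℝ)) ^ (2 : ℕ) := by ring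
        _ = 16 * |t| ^ (1 / 2 : ℝ) := by rw [← Real.rpow_natCast, ← Real.rpow_mul ht0.le]; norm_num
    have h2 : |t| ^ (1 / 2 : ℝ) / |t| ^ (3 : ℝ) ≤ (|t| ^ (2 : ℝ))⁻¹ := by
      rw [← Real.rpow_sub ht0, ← Real.rpow_neg ht0.le]
      exact Real.rpow_le_rpow_of_exponent_le ht1 (by norm_num)
    calc Real.log |t| ^ 2 / |t| ^ (3 : ℝ) ≤ 16 * |t| ^ (1 / 2 : ℝ) / |t| ^ (3 : ℝ) := by gcongr
      _ = 16 * (|t| ^ (1 / 2 : ℝ) / |t| ^ (3 : ℝ)) := by ring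
      _ ≤ 16 * (2 * (1 + t ^ 2)⁻¹) := by gcongr; exact h2.trans hkey
      _ = 32 * (1 + t ^ 2)⁻¹ := by ring
  · have h1 : Real.log |t| ^ 4 ≤ 256 * |t| ^ (1 : ℝ) := by
      calc Real.log |t| ^ 4 ≤ (4 * |t| ^ (1 / 4 : ℝ)) ^ 4 := pow_le_pow_left₀ hlog0 hlog 4
        _ = 256 * (|t| ^ (1 / 4 : ℝ)) ^ (4 : ℕ) := by ring
        _ = 256 * |t| ^ (1 : ℝ) := by rw [← Real.rpow_natCast, ← Real.rpow_mul ht0.le]; norm_num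
    have h2 : |t| ^ (1 : ℝ) / |t| ^ (5 : ℝ) ≤ (1 / 8) * (|t| ^ (2 : ℝ))⁻¹ := by
      have e1 : |t| ^ (1 : ℝ) / |t| ^ (5 : ℝ) = |t| ^ (-2 : ℝ) * |t| ^ (-2 : ℝ) := by
        rw [← Real.rpow_sub ht0, ← Real.rpow_add ht0]; norm_num
      rw [e1]
      have h8 : (8 : ℝ) ≤ |t| ^ (2 : ℝ) := by rw [← hsq]; linarith
      have : |t| ^ (-2 : ℝ) ≤ 1 / 8 := by
        rw [Real.rpow_neg ht0.le]; rw [show (1:ℝ)/8 = (8:ℝ)⁻¹ by norm_num]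
        exact inv_anti₀ (by norm_num) h8
      have h0 : 0 ≤ |t| ^ (-2 : ℝ) := Real.rpow_nonneg ht0.le _
      calc |t| ^ (-2 : ℝ) * |t| ^ (-2 : ℝ) ≤ (1 / 8) * |t| ^ (-2 : ℝ) := by gcongr
        _ = (1 / 8) * (|t| ^ (2 : ℝ))⁻¹ := by rw [Real.rpow_neg ht0.le]
    calc Real.log |t| ^ 4 / |t| ^ (5 : ℝ) ≤ 256 * |t| ^ (1 : ℝ) / |t| ^ (5 : ℝ) := by gcongr
      _ = 256 * (|t| ^ (1 : ℝ) / |t| ^ (5 : ℝ)) := by ring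
      _ ≤ 256 * ((1 / 8) * (2 * (1 + t ^ 2)⁻¹)) := by
          gcongr
          exact h2.trans (by gcongr)
      _ = 64 * (1 + t ^ 2)⁻¹ := by ring


section Pointwise

variable {K : ℝ → ℝ} (hK : IsCIKernel K) {κ ℓ ε₁ ε₂ : ℝ} {v w q : ℕ}
  (hq : Squarefree q) (hvw : v * w = q) (hκ0 : 0 ≤ κ) (hκ1 : κ ≤ 1) (hε₁ : |ε₁| ≤ 1) (hε₂ : |ε₂| ≤ 1)
include hq hvw hκ0 hκ1 hε₁ hε₂

/-- Region-1 prefactor: `‖κℓ²(ε₁F_{v,w}+ε₂F_{w,v})(s)‖² ≤ 120 ℓ⁴` for `Re s ≥ 0`, `|Im s| ≤ (log q)^{-1/3}`,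
`q ≥ 5`. [cite: ConreyIwaniec2002, §4 (4.34)] -/
theorem norm_sq_prefactor_near (hq5 : 5 ≤ q) {s : ℂ} (hs : 0 ≤ s.re)
    (ht : |s.im| ≤ (Real.log q) ^ (-(1 / 3 : ℝ))) :
    ‖(((κ * ℓ ^ 2 : ℝ) : ℂ) * ((ε₁ : ℂ) * genusZFactor v w s + (ε₂ : ℂ) * genusZFactor w v s))‖ ^ 2 ≤
      120 * ℓ ^ 4 := by
  have hwv : w * v = q := by rw [mul_comm]; exact hvw
  have hF1 := norm_sq_genusZFactor_le_near_zero hq hq5 hvw hs ht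
  have hF2 := norm_sq_genusZFactor_le_near_zero hq hq5 hwv hs ht
  have hn1 := norm_nonneg (genusZFactor v w s)
  have hn2 := norm_nonneg (genusZFactor w v s)
  have h1 : ‖(((κ * ℓ ^ 2 : ℝ) : ℂ) *
      ((ε₁ : ℂ) * genusZFactor v w s + (ε₂ : ℂ) * genusZFactor w v s))‖ ≤
      ℓ ^ 2 * (‖genusZFactor v w s‖ + ‖genusZFactor w v s‖) := by
    rw [norm_mul, Complex.norm_real, Real.norm_eq_abs, abs_of_nonneg (by positivity)]
    have ha : ‖(ε₁ : ℂ) * genusZFactor v w s + (ε₂ : ℂ) * genusZFactor w v s‖ ≤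
        ‖genusZFactor v w s‖ + ‖genusZFactor w v s‖ := by
      refine (norm_add_le _ _).trans ?_
      rw [norm_mul, norm_mul, Complex.norm_real, Complex.norm_real, Real.norm_eq_abs, Real.norm_eq_abs]
      nlinarith
    calc κ * ℓ ^ 2 * ‖(ε₁ : ℂ) * genusZFactor v w s + (ε₂ : ℂ) * genusZFactor w v s‖
        ≤ 1 * ℓ ^ 2 * (‖genusZFactor v w s‖ + ‖genusZFactor w v s‖) := by gcongr
      _ = ℓ ^ 2 * (‖genusZFactor v w s‖ + ‖genusZFactor w v s‖) := by ring
  have hsum : (‖genusZFactor v w s‖ + ‖genusZFactor w v s‖) ^ 2 ≤ 120 := by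
    nlinarith
  calc _ ≤ (ℓ ^ 2 * (‖genusZFactor v w s‖ + ‖genusZFactor w v s‖)) ^ 2 :=
        pow_le_pow_left₀ (norm_nonneg _) h1 2
    _ = ℓ ^ 4 * (‖genusZFactor v w s‖ + ‖genusZFactor w v s‖) ^ 2 := by ring
    _ ≤ ℓ ^ 4 * 120 := by gcongr
    _ = 120 * ℓ ^ 4 := by ring

/-- Crude prefactor: `‖κℓ²(ε₁F_{v,w}+ε₂F_{w,v})(s)‖² ≤ 4ℓ⁴(1+log q)²` for `Re s ≥ 0`.
[cite: ConreyIwaniec2002, §4 (4.34)] -/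
theorem norm_sq_prefactor_crude {s : ℂ} (hs : 0 ≤ s.re) :
    ‖(((κ * ℓ ^ 2 : ℝ) : ℂ) * ((ε₁ : ℂ) * genusZFactor v w s + (ε₂ : ℂ) * genusZFactor w v s))‖ ^ 2 ≤
      4 * ℓ ^ 4 * (1 + Real.log q) ^ 2 := by
  have h := norm_prefactor_le (ℓ := ℓ) hq hvw hκ0 hκ1 hε₁ hε₂ hs
  calc _ ≤ (2 * ℓ ^ 2 * (1 + Real.log q)) ^ 2 := pow_le_pow_left₀ (norm_nonneg _) h 2
    _ = 4 * ℓ ^ 4 * (1 + Real.log q) ^ 2 := by ring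

end Pointwise

/-- Squares of the far core bounds in `(1+t²)⁻¹` form: for `|t| ≥ 3`, `0 < c ≤ 1/2`,
`‖core(c+it)‖² ≤ (2646²·64 + 630²·32)(1+t²)⁻¹`, using the refined bound when `log|t| ≤ 1/(2c)`… here
packaged for `c = σ₀` with the dichotomy `log|t| ≤ L` or not. [cite: ConreyIwaniec2002, §6 (6.33)] -/
theorem norm_sq_core_far_le {K : ℝ → ℝ} (hK : IsCIKernel K) {c t L : ℝ} (hc : 0 < c) (hc2 : c ≤ 1 / 2)
    (hcL : c = (2 * L)⁻¹) (ht : 3 ≤ |t|) :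
    ‖dslope (mellin fun x : ℝ => ((ciL K x : ℝ) : ℂ)) 1 (c + t * I) * riemannZeta₁ (c + t * I) *
        riemannZeta (c + t * I + 1)‖ ^ 2 ≤ (2646 ^ 2 * 64 + 630 ^ 2 * 32) * (1 + t ^ 2)⁻¹ := by
  have ht0 : 0 < |t| := by linarith
  have hnn := norm_nonneg (dslope (mellin fun x : ℝ => ((ciL K x : ℝ) : ℂ)) 1 (c + t * I) *
    riemannZeta₁ (c + t * I) * riemannZeta (c + t * I + 1))
  obtain ⟨hfa, hfb⟩ := norm_core_far_le hK (c := c) (t := t) hc hc2 ht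
  obtain ⟨hw3, hw5⟩ := far_weights_le ht
  have hi0 : (0:ℝ) ≤ (1 + t ^ 2)⁻¹ := by positivity
  rcases le_or_gt (Real.log |t|) L with hlt | hlt
  · have hlog0 : 0 < Real.log |t| := Real.log_pos (by linarith)
    have hcl : c ≤ 1 / (2 * Real.log |t|) := by
      rw [hcL, one_div]; exact inv_anti₀ (by positivity) (by linarith)
    have h := hfb hcl
    calc _ ≤ (2646 * Real.log |t| ^ 2 / |t| ^ (5 / 2 : ℝ)) ^ 2 := pow_le_pow_left₀ hnn h 2
      _ = 2646 ^ 2 * (Real.log |t| ^ 4 / |t| ^ (5 : ℝ)) := by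
          have e : (|t| ^ (5 / 2 : ℝ)) ^ 2 = |t| ^ (5 : ℝ) := by
            rw [← Real.rpow_natCast, ← Real.rpow_mul ht0.le]; norm_num
          rw [div_pow, mul_pow, e]; ring
      _ ≤ 2646 ^ 2 * (64 * (1 + t ^ 2)⁻¹) := by gcongr
      _ ≤ (2646 ^ 2 * 64 + 630 ^ 2 * 32) * (1 + t ^ 2)⁻¹ := by nlinarith
  · calc _ ≤ (630 * Real.log |t| / |t| ^ (3 / 2 : ℝ)) ^ 2 := pow_le_pow_left₀ hnn hfa 2
      _ = 630 ^ 2 * (Real.log |t| ^ 2 / |t| ^ (3 : ℝ)) := by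
          have e : (|t| ^ (3 / 2 : ℝ)) ^ 2 = |t| ^ (3 : ℝ) := by
            rw [← Real.rpow_natCast, ← Real.rpow_mul ht0.le]; norm_num
          rw [div_pow, mul_pow, e]; ring
      _ ≤ 630 ^ 2 * (32 * (1 + t ^ 2)⁻¹) := by gcongr
      _ ≤ (2646 ^ 2 * 64 + 630 ^ 2 * 32) * (1 + t ^ 2)⁻¹ := by nlinarith

/-- Weight algebra, region 1: `C²/(a²+t²)² ≤ C² a⁻⁴ (1 + (t/a)²)⁻¹`. [folklore] -/
private theorem weight_near {C a t : ℝ} (ha : 0 < a) :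
    C ^ 2 / (a ^ 2 + t ^ 2) ^ 2 ≤ C ^ 2 * ((a ^ 4)⁻¹ * (1 + (a⁻¹ * t) ^ 2)⁻¹) := by
  have e : (a ^ 4)⁻¹ * (1 + (a⁻¹ * t) ^ 2)⁻¹ = (a ^ 2 * (a ^ 2 + t ^ 2))⁻¹ := by
    field_simp
  rw [e, div_eq_mul_inv]
  have hat : 0 < a ^ 2 + t ^ 2 := by positivity
  refine mul_le_mul_of_nonneg_left (inv_anti₀ (by positivity) ?_) (sq_nonneg C)
  rw [sq (a ^ 2 + t ^ 2)]
  exact mul_le_mul_of_nonneg_right (by nlinarith [sq_nonneg t]) hat.le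

/-- Weight algebra, region 2 (`a ≤ |t|`): `C²/(b²+t²)² ≤ 4C² a⁻⁴ (1 + (t/a)²)⁻¹`. [folklore] -/
private theorem weight_mid {C a b t : ℝ} (ha : 0 < a) (hat : a ≤ |t|) :
    C ^ 2 / (b ^ 2 + t ^ 2) ^ 2 ≤ 4 * C ^ 2 * ((a ^ 4)⁻¹ * (1 + (a⁻¹ * t) ^ 2)⁻¹) := by
  have e : (a ^ 4)⁻¹ * (1 + (a⁻¹ * t) ^ 2)⁻¹ = (a ^ 2 * (a ^ 2 + t ^ 2))⁻¹ := by
    field_simp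
  have h1 : a ^ 2 ≤ t ^ 2 := by rw [← sq_abs t]; exact pow_le_pow_left₀ ha.le hat 2
  have ht2 : 0 < t ^ 2 := lt_of_lt_of_le (by positivity) h1
  rw [e, div_eq_mul_inv, show 4 * C ^ 2 * (a ^ 2 * (a ^ 2 + t ^ 2))⁻¹ =
    C ^ 2 * ((a ^ 2 * (a ^ 2 + t ^ 2)) / 4)⁻¹ by rw [inv_div]; ring]
  refine mul_le_mul_of_nonneg_left (inv_anti₀ (by positivity) ?_) (sq_nonneg C)
  -- `a²(a²+t²)/4 ≤ (t²)² ≤ (b²+t²)²`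
  have h2 : a ^ 2 * (a ^ 2 + t ^ 2) / 4 ≤ t ^ 2 * t ^ 2 := by nlinarith
  have h3 : t ^ 2 * t ^ 2 ≤ (b ^ 2 + t ^ 2) ^ 2 := by nlinarith [sq_nonneg b, sq_nonneg (b^2)]
  linarith

/-- **THE MEAN SQUARE OF `Φ` ON `Re s = σ₀ = 1/(2 log q)` IS `≪ ℓ⁴ log³ q`, ABSOLUTELY.**
[cite: ConreyIwaniec2002, §6 (6.33)–(6.35), (6.25)–(6.26)] -/
theorem exists_integral_norm_sq_genusPhi_le :
    ∃ C : ℝ, 0 < C ∧ ∀ (K : ℝ → ℝ), IsCIKernel K → ∀ (q v w : ℕ) (κ ℓ ε₁ ε₂ : ℝ),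
      Squarefree q → 5 ≤ q → v * w = q → 0 ≤ κ → κ ≤ 1 → |ε₁| ≤ 1 → |ε₂| ≤ 1 →
        Integrable (fun t : ℝ =>
          ‖genusPhi K κ ℓ ε₁ ε₂ v w (((1 / (2 * Real.log q) : ℝ) : ℂ) + t * I)‖ ^ 2) ∧
        ∫ t : ℝ, ‖genusPhi K κ ℓ ε₁ ε₂ v w (((1 / (2 * Real.log q) : ℝ) : ℂ) + t * I)‖ ^ 2 ≤
          C * ℓ ^ 4 * Real.log q ^ 3 := by
  obtain ⟨C₀, hC₀, hnear⟩ := exists_bound_core_near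
  set W : ℝ := 2646 ^ 2 * 64 + 630 ^ 2 * 32 with hW
  have hW0 : 0 ≤ W := by rw [hW]; norm_num
  refine ⟨1024 * Real.pi * C₀ ^ 2 + 16 * Real.pi * W + 1, by positivity, ?_⟩
  intro K hK q v w κ ℓ ε₁ ε₂ hq hq5 hvw hκ0 hκ1 hε₁ hε₂
  have hq5' : (5 : ℝ) ≤ q := by exact_mod_cast hq5
  set L : ℝ := Real.log q with hL
  have hL1 : 1 ≤ L := by
    rw [hL, ← Real.log_exp 1]
    exact Real.log_le_log (Real.exp_pos 1) (by linarith [Real.exp_one_lt_three])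
  have hL0 : 0 < L := by linarith
  set σ₀ : ℝ := 1 / (2 * Real.log q) with hσ₀
  have hσ₀L : σ₀ = (2 * L)⁻¹ := by rw [hσ₀, hL, one_div]
  have hσ₀0 : 0 < σ₀ := by rw [hσ₀L]; positivity
  have hσ₀2 : σ₀ ≤ 1 / 2 := by
    rw [hσ₀L, inv_le_comm₀ (by positivity) (by norm_num)]; linarith
  set τ : ℝ := L ^ (-(1 / 3 : ℝ)) with hτ
  have hτ0 : 0 < τ := Real.rpow_pos_of_pos hL0 _
  have hτ3 : τ ^ (3 : ℕ) = L⁻¹ := by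
    rw [hτ, ← Real.rpow_natCast, ← Real.rpow_mul hL0.le, ← Real.rpow_neg_one]; norm_num
  -- dominating function
  set A₁ : ℝ := 120 * C₀ ^ 2 * ℓ ^ 4 * (σ₀ ^ 4)⁻¹ with hA₁
  set A₂ : ℝ := 16 * (1 + L) ^ 2 * C₀ ^ 2 * ℓ ^ 4 * (τ ^ 4)⁻¹ with hA₂
  set A₃ : ℝ := 4 * ℓ ^ 4 * (1 + L) ^ 2 * W with hA₃
  have hA₁0 : 0 ≤ A₁ := by rw [hA₁]; positivity
  have hA₂0 : 0 ≤ A₂ := by rw [hA₂]; positivity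
  have hA₃0 : 0 ≤ A₃ := by rw [hA₃]; positivity
  set g : ℝ → ℝ := fun t =>
    A₁ * (1 + (σ₀⁻¹ * t) ^ 2)⁻¹ + A₂ * (1 + (τ⁻¹ * t) ^ 2)⁻¹ + A₃ * (1 + t ^ 2)⁻¹ with hg
  obtain ⟨hi1, hv1⟩ := integral_inv_one_add_sq_scaled hσ₀0
  obtain ⟨hi2, hv2⟩ := integral_inv_one_add_sq_scaled hτ0
  have hgi : Integrable g :=
    ((hi1.const_mul A₁).add (hi2.const_mul A₂)).add (integrable_inv_one_add_sq.const_mul A₃)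
  have hcont : Continuous fun t : ℝ => ‖genusPhi K κ ℓ ε₁ ε₂ v w ((σ₀ : ℂ) + t * I)‖ ^ 2 :=
    ((continuous_genusPhi_vertical (κ := κ) (ℓ := ℓ) (ε₁ := ε₁) (ε₂ := ε₂) (v := v) (w := w) hK
      hσ₀0 (by linarith)).norm).pow 2
  -- pointwise domination
  have hdom : ∀ t : ℝ, ‖genusPhi K κ ℓ ε₁ ε₂ v w ((σ₀ : ℂ) + t * I)‖ ^ 2 ≤ g t := by
    intro t
    set s : ℂ := (σ₀ : ℂ) + t * I with hs
    have hre : s.re = σ₀ := by simp [hs]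
    have him : s.im = t := by simp [hs]
    have hns : ‖s‖ ^ 2 = σ₀ ^ 2 + t ^ 2 := by
      rw [Complex.sq_norm, Complex.normSq_apply]; simp [hs]; ring
    have w1nn : 0 ≤ A₁ * (1 + (σ₀⁻¹ * t) ^ 2)⁻¹ := by positivity
    have w2nn : 0 ≤ A₂ * (1 + (τ⁻¹ * t) ^ 2)⁻¹ := by positivity
    have w3nn : 0 ≤ A₃ * (1 + t ^ 2)⁻¹ := by positivity
    have hsplit : ‖genusPhi K κ ℓ ε₁ ε₂ v w s‖ ^ 2 =
        ‖(((κ * ℓ ^ 2 : ℝ) : ℂ) * ((ε₁ : ℂ) * genusZFactor v w s + (ε₂ : ℂ) * genusZFactor w v s))‖ ^ 2 *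
          ‖dslope (mellin fun x : ℝ => ((ciL K x : ℝ) : ℂ)) 1 s * riemannZeta₁ s * riemannZeta (s + 1)‖ ^ 2 := by
      rw [genusPhi, norm_mul, mul_assoc, mul_pow]
    have hcore_nn : 0 ≤ ‖dslope (mellin fun x : ℝ => ((ciL K x : ℝ) : ℂ)) 1 s * riemannZeta₁ s *
        riemannZeta (s + 1)‖ := norm_nonneg _
    rw [hsplit]
    rcases le_or_gt |t| 3 with ht3 | ht3
    · have hcore : ‖dslope (mellin fun x : ℝ => ((ciL K x : ℝ) : ℂ)) 1 s * riemannZeta₁ s *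
          riemannZeta (s + 1)‖ ≤ C₀ / (σ₀ ^ 2 + t ^ 2) := by
        have h := hnear K hK s (by rw [hre]; exact hσ₀0) (by rw [hre]; exact hσ₀2) (by rw [him]; exact ht3)
        rwa [hns] at h
      have hcore2 : ‖dslope (mellin fun x : ℝ => ((ciL K x : ℝ) : ℂ)) 1 s * riemannZeta₁ s *
          riemannZeta (s + 1)‖ ^ 2 ≤ C₀ ^ 2 / (σ₀ ^ 2 + t ^ 2) ^ 2 := by
        rw [← div_pow]; exact pow_le_pow_left₀ hcore_nn hcore 2
      rcases le_or_gt |t| τ with htτ | htτ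
      · have hpre1 := norm_sq_prefactor_near (κ := κ) (ℓ := ℓ) hq hvw hκ0 hκ1 hε₁ hε₂ hq5 (s := s)
          (by rw [hre]; exact hσ₀0.le) (by rw [him]; exact htτ)
        have hw1 := weight_near (C := C₀) (t := t) hσ₀0
        calc _ ≤ (120 * ℓ ^ 4) * (C₀ ^ 2 * ((σ₀ ^ 4)⁻¹ * (1 + (σ₀⁻¹ * t) ^ 2)⁻¹)) :=
              mul_le_mul hpre1 (hcore2.trans hw1) (by positivity) (by positivity)
          _ = A₁ * (1 + (σ₀⁻¹ * t) ^ 2)⁻¹ := by rw [hA₁]; ring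
          _ ≤ g t := by rw [hg]; linarith
      · have hpre2 := norm_sq_prefactor_crude (κ := κ) (ℓ := ℓ) hq hvw hκ0 hκ1 hε₁ hε₂ (s := s)
          (by rw [hre]; exact hσ₀0.le)
        have hw2 := weight_mid (C := C₀) (b := σ₀) (t := t) hτ0 htτ.le
        calc _ ≤ (4 * ℓ ^ 4 * (1 + Real.log q) ^ 2) * (4 * C₀ ^ 2 * ((τ ^ 4)⁻¹ * (1 + (τ⁻¹ * t) ^ 2)⁻¹)) :=
              mul_le_mul hpre2 (hcore2.trans hw2) (by positivity) (by positivity)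
          _ = A₂ * (1 + (τ⁻¹ * t) ^ 2)⁻¹ := by rw [hA₂, hL]; ring
          _ ≤ g t := by rw [hg]; linarith
    · have hpre2 := norm_sq_prefactor_crude (κ := κ) (ℓ := ℓ) hq hvw hκ0 hκ1 hε₁ hε₂ (s := s)
        (by rw [hre]; exact hσ₀0.le)
      have hcore3 := norm_sq_core_far_le hK (L := L) hσ₀0 hσ₀2 hσ₀L ht3.le
      calc _ ≤ (4 * ℓ ^ 4 * (1 + Real.log q) ^ 2) * ((2646 ^ 2 * 64 + 630 ^ 2 * 32) * (1 + t ^ 2)⁻¹) :=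
            mul_le_mul hpre2 hcore3 (by positivity) (by positivity)
        _ = A₃ * (1 + t ^ 2)⁻¹ := by rw [hA₃, hW, hL]; ring
        _ ≤ g t := by rw [hg]; linarith
  have hint : Integrable fun t : ℝ => ‖genusPhi K κ ℓ ε₁ ε₂ v w ((σ₀ : ℂ) + t * I)‖ ^ 2 :=
    Integrable.mono' hgi hcont.aestronglyMeasurable (Eventually.of_forall fun t => by
      rw [Real.norm_of_nonneg (by positivity)]; exact hdom t)
  refine ⟨hint, ?_⟩
  have hI1 : Integrable (fun t : ℝ => A₁ * (1 + (σ₀⁻¹ * t) ^ 2)⁻¹) := hi1.const_mul A₁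
  have hI2 : Integrable (fun t : ℝ => A₂ * (1 + (τ⁻¹ * t) ^ 2)⁻¹) := hi2.const_mul A₂
  have hI3 : Integrable (fun t : ℝ => A₃ * (1 + t ^ 2)⁻¹) := integrable_inv_one_add_sq.const_mul A₃
  have hI12 : Integrable (fun t : ℝ => A₁ * (1 + (σ₀⁻¹ * t) ^ 2)⁻¹ + A₂ * (1 + (τ⁻¹ * t) ^ 2)⁻¹) :=
    hI1.add hI2
  have hgval : ∫ t, g t = A₁ * (σ₀ * Real.pi) + A₂ * (τ * Real.pi) + A₃ * Real.pi := by
    simp only [hg]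
    rw [integral_add hI12 hI3, integral_add hI1 hI2, integral_const_mul, integral_const_mul,
      integral_const_mul, hv1, hv2, integral_univ_inv_one_add_sq]
  -- evaluate: `A₁ σ₀ π = 120 π C₀² ℓ⁴ σ₀⁻³ = 960 π C₀² ℓ⁴ L³`, `A₂ τ π = 16 π (1+L)² C₀² ℓ⁴ L`
  have e1 : A₁ * (σ₀ * Real.pi) = 960 * Real.pi * C₀ ^ 2 * ℓ ^ 4 * L ^ 3 := by
    rw [hA₁, hσ₀L]; field_simp; ring
  have e2 : A₂ * (τ * Real.pi) = 16 * Real.pi * (1 + L) ^ 2 * C₀ ^ 2 * ℓ ^ 4 * L := by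
    have hτne : τ ≠ 0 := hτ0.ne'
    have : (τ ^ 4)⁻¹ * τ = (τ ^ (3 : ℕ))⁻¹ := by field_simp
    calc A₂ * (τ * Real.pi) = 16 * Real.pi * (1 + L) ^ 2 * C₀ ^ 2 * ℓ ^ 4 * ((τ ^ 4)⁻¹ * τ) := by
          rw [hA₂]; ring
      _ = 16 * Real.pi * (1 + L) ^ 2 * C₀ ^ 2 * ℓ ^ 4 * L := by rw [this, hτ3, inv_inv]
  have hbound : A₁ * (σ₀ * Real.pi) + A₂ * (τ * Real.pi) + A₃ * Real.pi ≤
      (1024 * Real.pi * C₀ ^ 2 + 16 * Real.pi * W + 1) * ℓ ^ 4 * L ^ 3 := by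
    rw [e1, e2, hA₃]
    have h1 : (1 + L) ^ 2 ≤ 4 * L ^ 2 := by nlinarith
    have hL23 : L ^ 2 ≤ L ^ 3 := by
      calc L ^ 2 = L ^ 2 * 1 := by ring
        _ ≤ L ^ 2 * L := by gcongr
        _ = L ^ 3 := by ring
    have h2 : (1 + L) ^ 2 * L ≤ 4 * L ^ 3 := by
      calc (1 + L) ^ 2 * L ≤ 4 * L ^ 2 * L := mul_le_mul_of_nonneg_right h1 hL0.le
        _ = 4 * L ^ 3 := by ring
    have h3 : (1 + L) ^ 2 ≤ 4 * L ^ 3 := h1.trans (by linarith)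
    have hx : 0 ≤ Real.pi * C₀ ^ 2 * ℓ ^ 4 := by positivity
    have hy : 0 ≤ Real.pi * W * ℓ ^ 4 := by positivity
    have hz : 0 ≤ ℓ ^ 4 * L ^ 3 := by positivity
    calc 960 * Real.pi * C₀ ^ 2 * ℓ ^ 4 * L ^ 3 + 16 * Real.pi * (1 + L) ^ 2 * C₀ ^ 2 * ℓ ^ 4 * L +
          4 * ℓ ^ 4 * (1 + L) ^ 2 * W * Real.pi
        = 960 * (Real.pi * C₀ ^ 2 * ℓ ^ 4) * L ^ 3 + 16 * (Real.pi * C₀ ^ 2 * ℓ ^ 4) * ((1 + L) ^ 2 * L) +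
          4 * (Real.pi * W * ℓ ^ 4) * (1 + L) ^ 2 := by ring
      _ ≤ 960 * (Real.pi * C₀ ^ 2 * ℓ ^ 4) * L ^ 3 + 16 * (Real.pi * C₀ ^ 2 * ℓ ^ 4) * (4 * L ^ 3) +
          4 * (Real.pi * W * ℓ ^ 4) * (4 * L ^ 3) := by gcongr
      _ = (1024 * Real.pi * C₀ ^ 2 + 16 * Real.pi * W) * ℓ ^ 4 * L ^ 3 := by ring
      _ ≤ (1024 * Real.pi * C₀ ^ 2 + 16 * Real.pi * W + 1) * ℓ ^ 4 * L ^ 3 := by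
          have : 0 ≤ 1 * ℓ ^ 4 * L ^ 3 := by positivity
          linarith
  calc ∫ t : ℝ, ‖genusPhi K κ ℓ ε₁ ε₂ v w ((σ₀ : ℂ) + t * I)‖ ^ 2 ≤ ∫ t, g t :=
        integral_mono hint hgi hdom
    _ ≤ (1024 * Real.pi * C₀ ^ 2 + 16 * Real.pi * W + 1) * ℓ ^ 4 * Real.log q ^ 3 := by
        rw [hgval, ← hL]; exact hbound

end OffDiagPhiL2

end ConreyIwaniec2002

end Literature.NumberTheory.LFunctions

end
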